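/-
Copyright: b2b-lace packet (tail-bound analyst, gen 2). Elementary "termwise domination" over the
hyperoctahedral group W_d = signed permutations, used to transport sup_{x ≠ 0} bounds of the SRW
integrals K_{n,l}(x) to finitely many representatives (KSUP.md §8, rule WSUP-PRINT).
-/
import Literature.Probability.FitznerVanDerHofstad2017.SrwIntegralWSplit

/-!
# Termwise domination over signed permutations

For `x ∈ ℤ^d` with support `S` and `x_μ ≥ 1` on `S`, and for EVERY signed permutation
`σ = (ν, δ)` (acting by `(σ x)_j = δ_j x_{ν j}`, [FvdH17-NoBLE] Def. 2.5), each coordinate of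
`1_S - σ 1_S` is dominated in absolute value by the same coordinate of `x - σ x`; and
`2e_i - σ(2e_i)` is dominated by `a e_i - σ(a e_i)` when `|a| ≥ 2`.  Consequently, for any
`f : ℤ^d → ℝ` that is non-increasing under coordinatewise domination of absolute values
(for `f = I_{n,2j}`, `j ≥ 1`, this is asserted in Fitzner's thesis (4.1.x) p. 101 / [FvdH17-NoBLE]
Lemma 5.1, whose proof-citation [HS92b, Lemma B.3] covers `I_{n,0}` only — REFEREE v12 R46; a
hypothesis here, NOT proved in this file), the orbit averages `(2^d d!)⁻¹ Σ_σ f(x - σ x)` are maximised, among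
all `x` with a given support size `r ≥ 2`, at `x = 1_S`, and among `x = a e_i`, `|a| ≥ 2`, at `2 e_i`.
No analysis is used: these are finite statements about sums.
-/

namespace Literature.Probability.FitznerVanDerHofstad2017

open Finset

variable {d : ℕ}

/-- The signed-permutation image `p(x; ν, δ)_j = δ_j · x_{ν j}`.
[cite: FitznerVanDerHofstad2016NoBLE, Def. 2.5 p. 1058] -/
def sgnPerm (ν : Equiv.Perm (Fin d)) (δ : Fin d → ℤˣ) (x : Fin d → ℤ) : Fin d → ℤ :=
  fun j => (δ j : ℤ) * x (ν j)

/-- The indicator vector `1_S ∈ ℤ^d` of a set of coordinates. [folklore] -/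
def indicatorVec (S : Finset (Fin d)) : Fin d → ℤ := fun μ => if μ ∈ S then 1 else 0

/-- Unfolding lemma for `sgnPerm`. [folklore] -/
theorem sgnPerm_apply (ν : Equiv.Perm (Fin d)) (δ : Fin d → ℤˣ) (x : Fin d → ℤ) (j : Fin d) :
    sgnPerm ν δ x j = (δ j : ℤ) * x (ν j) := rfl

/-- Unfolding lemma for `indicatorVec`. [folklore] -/
theorem indicatorVec_apply (S : Finset (Fin d)) (μ : Fin d) :
    indicatorVec S μ = if μ ∈ S then 1 else 0 := rfl

/-- The scalar core of the domination lemma: indicator values `ia, ib ∈ {0,1}` matched with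
`a, b` (`ia = 1 ↔ a ≥ 1`, `ia = 0 ↔ a = 0`), sign `s = ±1`. [folklore] -/
theorem dom_core (s a b ia ib : ℤ) (hs : s = 1 ∨ s = -1)
    (ha : (ia = 1 ∧ 1 ≤ a) ∨ (ia = 0 ∧ a = 0)) (hb : (ib = 1 ∧ 1 ≤ b) ∨ (ib = 0 ∧ b = 0)) :
    |ia - s * ib| ≤ |a - s * b| := by
  rcases hs with rfl | rfl
  · rcases ha with ⟨rfl, ha⟩ | ⟨rfl, rfl⟩ <;> rcases hb with ⟨rfl, hb⟩ | ⟨rfl, rfl⟩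
    · simp
    · simp only [mul_zero, sub_zero, abs_one]
      exact le_abs.mpr (Or.inl ha)
    · simp only [one_mul, zero_sub, abs_neg, abs_one]
      exact le_abs.mpr (Or.inl hb)
    · simp
  · rcases ha with ⟨rfl, ha⟩ | ⟨rfl, rfl⟩ <;> rcases hb with ⟨rfl, hb⟩ | ⟨rfl, rfl⟩
    · have h1 : |(1 : ℤ) - -1 * 1| = 2 := by norm_num
      rw [h1]
      exact le_abs.mpr (Or.inl (by linarith))
    · simp only [mul_zero, sub_zero, abs_one]
      exact le_abs.mpr (Or.inl ha)
    · have h1 : |(0 : ℤ) - -1 * 1| = 1 := by norm_num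
      rw [h1]
      exact le_abs.mpr (Or.inl (by linarith))
    · simp

/-- TERMWISE DOMINATION (support version): if `x_μ ≥ 1` on `S` and `x_μ = 0` off `S`, then for
every signed permutation `(ν, δ)` and every coordinate `μ`,
`|(1_S - σ 1_S)_μ| ≤ |(x - σ x)_μ|`. (b2b-lace KSUP.md §8 (W4).) [folklore] -/
theorem abs_indicator_sub_sgnPerm_le (S : Finset (Fin d)) (x : Fin d → ℤ)
    (hS : ∀ μ ∈ S, 1 ≤ x μ) (hS' : ∀ μ, μ ∉ S → x μ = 0)
    (ν : Equiv.Perm (Fin d)) (δ : Fin d → ℤˣ) (μ : Fin d) :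
    |(indicatorVec S - sgnPerm ν δ (indicatorVec S)) μ| ≤ |(x - sgnPerm ν δ x) μ| := by
  simp only [Pi.sub_apply, sgnPerm_apply, indicatorVec_apply]
  have hs : ((δ μ : ℤˣ) : ℤ) = 1 ∨ ((δ μ : ℤˣ) : ℤ) = -1 := by
    rcases Int.units_eq_one_or (δ μ) with h | h <;> simp [h]
  apply dom_core _ _ _ _ _ hs
  · by_cases hμ : μ ∈ S
    · left; exact ⟨by simp [hμ], hS μ hμ⟩
    · right; exact ⟨by simp [hμ], hS' μ hμ⟩
  · by_cases hν : ν μ ∈ S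
    · left; exact ⟨by simp [hν], hS (ν μ) hν⟩
    · right; exact ⟨by simp [hν], hS' (ν μ) hν⟩

/-- The axis vector `a e_i ∈ ℤ^d`. [folklore] -/
def axisVec (i : Fin d) (a : ℤ) : Fin d → ℤ := fun j => if j = i then a else 0

/-- `a e_i - σ(a e_i) = a · (e_i - σ e_i)` coordinatewise. [folklore] -/
theorem axisVec_sub_sgnPerm (i : Fin d) (a : ℤ) (ν : Equiv.Perm (Fin d)) (δ : Fin d → ℤˣ)
    (μ : Fin d) :
    (axisVec i a - sgnPerm ν δ (axisVec i a)) μ = a * (axisVec i 1 - sgnPerm ν δ (axisVec i 1)) μ := by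
  simp only [Pi.sub_apply, sgnPerm_apply, axisVec]
  split_ifs <;> ring

/-- TERMWISE DOMINATION (axis version): `|(2e_i - σ 2e_i)_μ| ≤ |(a e_i - σ a e_i)_μ|` for
`|a| ≥ 2`. (b2b-lace KSUP.md §8 (W4b).) [folklore] -/
theorem abs_axis_sub_sgnPerm_le (i : Fin d) (a : ℤ) (ha : 2 ≤ |a|)
    (ν : Equiv.Perm (Fin d)) (δ : Fin d → ℤˣ) (μ : Fin d) :
    |(axisVec i 2 - sgnPerm ν δ (axisVec i 2)) μ| ≤ |(axisVec i a - sgnPerm ν δ (axisVec i a)) μ| := by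
  rw [axisVec_sub_sgnPerm i 2, axisVec_sub_sgnPerm i a, abs_mul, abs_mul]
  have h2 : |(2 : ℤ)| = 2 := by norm_num
  rw [h2]
  exact mul_le_mul_of_nonneg_right ha (abs_nonneg _)

/-- ORBIT-AVERAGE COMPARISON: if `f` is non-increasing under coordinatewise domination of
absolute values and `y - σ y` is dominated by `x - σ x` for every `σ`, then
`Σ_σ f (x - σ x) ≤ Σ_σ f (y - σ y)`. [folklore] -/
theorem sum_sgnPerm_le_of_dominated (f : (Fin d → ℤ) → ℝ)
    (hmono : ∀ z z' : Fin d → ℤ, (∀ μ, |z' μ| ≤ |z μ|) → f z ≤ f z')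
    (x y : Fin d → ℤ)
    (hdom : ∀ (ν : Equiv.Perm (Fin d)) (δ : Fin d → ℤˣ) (μ : Fin d),
      |(y - sgnPerm ν δ y) μ| ≤ |(x - sgnPerm ν δ x) μ|) :
    ∑ ν : Equiv.Perm (Fin d), ∑ δ : Fin d → ℤˣ, f (x - sgnPerm ν δ x) ≤
      ∑ ν : Equiv.Perm (Fin d), ∑ δ : Fin d → ℤˣ, f (y - sgnPerm ν δ y) := by
  apply Finset.sum_le_sum; intro ν _
  apply Finset.sum_le_sum; intro δ _
  exact hmono _ _ (hdom ν δ)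

/-- The orbit-average form of `W`: `Wsum f x = (2^d d!)⁻¹ Σ_{σ ∈ W_d} f (x - σ x)`; for
`f = I_{n,2j}` this is `W_{n,2j}(x)` ([FitznerVanDerHofstad2016NoBLE] (5.16) for `j = 0`).
[folklore] -/
noncomputable def orbitAvg (f : (Fin d → ℤ) → ℝ) (x : Fin d → ℤ) : ℝ :=
  (∑ ν : Equiv.Perm (Fin d), ∑ δ : Fin d → ℤˣ, f (x - sgnPerm ν δ x)) / (2 ^ d * (d.factorial : ℝ))

/-- SUPPORT REDUCTION: under the monotonicity hypothesis, the orbit average at any `x` with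
support `S`, `x ≥ 1` on `S`, is at most the orbit average at `1_S`.
(b2b-lace KSUP.md §8 (W4a).) [folklore] -/
theorem orbitAvg_le_indicator (f : (Fin d → ℤ) → ℝ)
    (hmono : ∀ z z' : Fin d → ℤ, (∀ μ, |z' μ| ≤ |z μ|) → f z ≤ f z')
    (S : Finset (Fin d)) (x : Fin d → ℤ)
    (hS : ∀ μ ∈ S, 1 ≤ x μ) (hS' : ∀ μ, μ ∉ S → x μ = 0) :
    orbitAvg f x ≤ orbitAvg f (indicatorVec S) := by
  unfold orbitAvg
  apply div_le_div_of_nonneg_right _ (by positivity)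
  exact sum_sgnPerm_le_of_dominated f hmono x (indicatorVec S)
    (fun ν δ μ => abs_indicator_sub_sgnPerm_le S x hS hS' ν δ μ)

/-- AXIS REDUCTION: the orbit average at `a e_i`, `|a| ≥ 2`, is at most the one at `2 e_i`.
(b2b-lace KSUP.md §8 (W4b).) [folklore] -/
theorem orbitAvg_le_two_axis (f : (Fin d → ℤ) → ℝ)
    (hmono : ∀ z z' : Fin d → ℤ, (∀ μ, |z' μ| ≤ |z μ|) → f z ≤ f z')
    (i : Fin d) (a : ℤ) (ha : 2 ≤ |a|) :
    orbitAvg f (axisVec i a) ≤ orbitAvg f (axisVec i 2) := by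
  unfold orbitAvg
  apply div_le_div_of_nonneg_right _ (by positivity)
  exact sum_sgnPerm_le_of_dominated f hmono _ _ (fun ν δ μ => abs_axis_sub_sgnPerm_le i a ha ν δ μ)

end Literature.Probability.FitznerVanDerHofstad2017
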